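import Literature.Algebra.EuclideanLattices.MRThm59Attempt
import Literature.Algebra.EuclideanLattices.DualGridProgram
import Literature.Computability.Cryptography.GuessedCoinCall
import Literature.Computability.Cryptography.SISFunctionSolver
import Literature.Probability.Distributions.PseudoGaussianSamplerCoins
import Literature.Computability.Cryptography.SamplerCoinLaws
import HarnessLib

/-!
# MR07 Thm. 5.9, the attempt machine I: the run as a list program, its agreement with the model's data, and its coin law

Topic `Algebra/EuclideanLattices` (family `pqc`). First of the files constructing the ATTEMPT MACHINE whose
law `MRThm59Attempt.attempt_success_of_law` turns into the hypothesis `H59a` of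
`MRThm59Shell.owfExist_of_gapSVP_worstCaseHard_of_incGDDAttempt`. One attempt of Micciancio–Regev 2007,
Thm. 5.9 (authors' version p. 22, steps 2–4) is written here as a TOTAL function of the instance
`J = (n, U, V, t, r)` (wire format `MRLemma510Function.IncGDDInst`), the guess index `i` and the coin
string, on lists of integers, reusing the list programs of `DualGridProgram.lean` (`AttData.aRowsL`,
`AttData.uVecL`) for the arithmetic of Lemma 5.8:

* `RunCtx` — the static data of a run (the `AttData` of the model on `B_U = invMatrix Uᵀ`, the number of
  samples `m`, the guessed position `j₀`, the shift row `Tsh`, the sampler `P = std (prec) b`, the box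
  length `ℓ`, the guess/supply lengths `W`, `R` of the oracle call) and **`ctxOf`** computing it from
  `(J, i)` through named components (`alphaOfJ`, `j0OfJ`, `ccOfJ = invDen(U)^{2n−2} (= c_U)`,
  `BrowsOfJ`: `U ↦ Uᵀ ↦ B_U = invMatrix Uᵀ` by Cohen's integral inverse columns `GSInverse.invCols`, twice;
  `DgOfJ`, `N1OfJ`, `NOfJ`, `SrowsOfJ = c·V`, `TSrowsOfJ` (`τⱼ = B_U sⱼ/Dg`), `dTOfJ`, `attDataOfJ`, `XOfJ`,
  `bOfJ`, `POfJ = std (precOf p n) b` with `precOf p n = 80 + size (p n)`, `ellOfJ`, `ROfJ = pB(matBound n m q)`,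
  `W = size R`, `TshOfJ`);
* the run: `Xs` (the `m·n` flat samplers on the chunks of the first coin segment), `Ks` (noises, the
  `j₀`-th shifted by `Tsh`), `kappas` (box vectors from `ℓ`-bit chunks of the second segment), `aRows`
  (the query columns), `valRows`/`query` (the string `encodeMatrix A`), `zAns` (the solver `B` called with
  a guessed coin count on the third segment, `GuessedCoinCall.callRun`, read by the total decoder
  `decodeIntVec m`), `uOut = uVecL`, and **`runOut`** (the answer `rawE intE (B_U u/Dg)`);
* agreement: `alphaOfNat_eq`, `guessIdx_div`/`guessIdx_mod`, `transposeL_eq_rowsOf_transpose`,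
  `transposeL_invCols_eq_rowsOf_invMatrix`, `invDen_pow_eq_cU`, **`ctxOf_d`** (the machine's `AttData` is
  the faithful `attDataOf (BU U) N (c·V) q` of `DualGridProgram`), `ctxOf_Tsh`, `ctxOf_P`, `ctxOf_ell`,
  `query_eq_encodeMatrix` (on faithful columns the query string is `encodeMatrix` of the model's matrix),
  `runOut_eq` (on faithful noises, boxes and answer the output is `rawE intE (zOf J (uVec …))`).

**The coin law** (second part of the file): over a UNIFORM coin string of any length `C ≥ c.coinTotal` the
law of `runOut` is the model analysed in `DualGridAttemptSuccess.lean`,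
`law(runOut) = (naturalAttemptWith B' N S ℓ'_P O_call Tsh ℓ).map (u ↦ rawE intE (B' u/Dg))` (an equality of
`PMF`s under `c.d = attDataOf B' N S q`, `c.Tsh = vecL T₀`), where `ℓ'_P = P.lawPMF` is the exact law of
the coin-driven sampler (`PseudoGaussianSamplerCoins`), `O_call A = (callLaw B W R (encodeMatrix A)).map (decodeIntVec m)`
the kernel of the guessed-coin call (`GuessedCoinCall`), `Tsh i = T₀` at `i = j₀`, `0` otherwise:
`runOut_eq_runSeg` (the run reads three segments), `uniformVector_bind_split` (a uniform string split at
`a` is an independent pair), `map_noiseSeg_eq` (noises `∼ ⨂ᵢ gridNoiseWith ℓ'_P (Tsh i)`: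
`uniformVector_map_chunks_eq_indepLaw`, `uniformVector_map_samplerVec_eq_indepLaw`, `indepLaw_map_pi`),
`map_boxSeg_eq` (boxes `∼ ⨂ᵢ boxLaw n ℓ`, the `ℓ`-bit words being uniform on `[0, 2^ℓ)`:
`uniformVector_map_bitsFin`), `map_callSeg_eq`, `runSeg_eq_model`, and
**`map_runOut_eq_naturalAttemptWith`**.

All definitions have bodies; no named fact. The typed polynomial-time realisation is the sequel.

## References

* D. Micciancio, O. Regev, *Worst-case to average-case reductions based on Gaussian measures*,
  SIAM J. Comput. 37 (2007) 267–302; authors' version, Thm. 5.9 (steps 1–4, p. 22), Lemma 5.8 (p. 21)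
  [MicciancioRegev2007].
* H. Cohen, *A Course in Computational Algebraic Number Theory*, GTM 138, 1993, §2.6.3 [Cohen1993].
* O. Goldreich, *Foundations of Cryptography I*, CUP 2001, §1.3.2 (invoking a PPT subroutine) [Goldreich2001].
* S. Arora, B. Barak, *Computational Complexity: A Modern Approach*, CUP 2009, Def. 7.1 (a probabilistic
  machine reads a uniform string; independent segments) [AroraBarak2009].
-/

noncomputable section

open scoped Classical ENNReal

namespace Literature.Algebra.EuclideanLattices

open Matrix GSInverse Finset Literature.Probability.Distributions MRLemma510 DualGrid PMF
  Literature.Computability.Complexity Literature.Computability.Complexity.CodeFP Literature.Computability.Complexity.LMat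
  Literature.Computability.Cryptography Literature.Computability.Cryptography.GuessedCoinCall Polynomial

namespace MRThm59

/-! ### The static data of a run -/

/-- **The static data of one attempt**: the list data of the model, the number of samples, the guessed
position, the shift row of the guessed sample, the sampler's parameters, the box length, and the two
lengths of the oracle call. [cite: MicciancioRegev2007, Thm. 5.9 (steps 1–4)] -/
structure RunCtx where
  /-- the list data `(n, rows of B_U, columns of G, Dg, N, rows of S', columns of GT, modM, q)` -/
  d : AttData
  /-- number of samples `m` -/
  m : ℕ
  /-- guessed position `j₀` -/
  j₀ : ℕ
  /-- shift row of sample `j₀` -/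
  Tsh : List ℤ
  /-- the coin-driven sampler's parameters -/
  P : PGParams
  /-- box length `ℓ` -/
  ℓ : ℕ
  /-- guess bits of the oracle call -/
  W : ℕ
  /-- coin supply of the oracle call -/
  R : ℕ

namespace RunCtx

variable (c : RunCtx)

/-- Coins of the noises. [folklore] -/
def len1 : ℕ := c.m * (c.d.n * c.P.coinLen)

/-- Coins of the boxes. [folklore] -/
def len2 : ℕ := c.m * (c.d.n * c.ℓ)

/-- All coins of a run. [folklore] -/
def coinTotal : ℕ := c.len1 + c.len2 + (c.W + c.R)

/-- **The sampled coordinates** `X_{i,t}`: the flat sampler on word `t` of block `i` of the first segment.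
[cite: MicciancioRegev2007, Lemma 5.7 (fine-grid form: iid coordinates)] -/
def Xs (r : List Bool) : List (List ℤ) := (blocksOf c.P.coinLen c.d.n c.m (r.take c.len1)).map fun ws => ws.map c.P.samplerFlat

/-- **The noises** `Kᵢ = Xᵢ + Tshᵢ` (`Tsh_{j₀} = Tsh`, the others `0`). [cite: MicciancioRegev2007, Thm. 5.9 (step 2)] -/
def Ks (r : List Bool) : List (List ℤ) := (c.Xs r).mapIdx fun i X => if i = c.j₀ then addL X c.Tsh else X

/-- **The box vectors** `κᵢ` from `ℓ`-bit words of the second segment. [folklore] -/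
def kappas (r : List Bool) : List (List ℤ) :=
  (blocksOf c.ℓ c.d.n c.m ((r.drop c.len1).take c.len2)).map fun ws => ws.map fun w => (Literature.Computability.Complexity.bitsToNat w : ℤ)

/-- **The query columns** `[aᵢⱼ]ⱼ` (column `i` of the `SIS` matrix). [cite: MicciancioRegev2007, Lemma 5.8 (step 3)] -/
def aRows (r : List Bool) : List (List ℤ) := c.d.aRowsL (c.Ks r) (c.kappas r)

/-- The rows of the `SIS` matrix as natural numbers: row `j` is `[aᵢⱼ]ᵢ`. [cite: MicciancioRegev2007, Def. 5.3] -/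
def valRows (r : List Bool) : List (List ℕ) := (List.range c.d.n).map fun j => (c.aRows r).map fun col => (col.getD j 0).toNat

/-- **The query string** `encodeMatrix A` in the code algebra. [cite: MicciancioRegev2007, Def. 5.3] -/
def query (r : List Bool) : List Bool := pairE natE (pairE natE (pairE natE (listE (listE natE)))) (c.d.n, (c.m, (c.d.q, c.valRows r)))

/-- **The answer of the `SIS′` solver**, called with a guessed coin count on the third segment and read by
the total decoder. [cite: MicciancioRegev2007, Thm. 5.9 (step 3); Goldreich2001, §1.3.2] -/
def zAns (B : RandAlg (List Bool) (List Bool)) (r : List Bool) : List ℤ :=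
  vecL (decodeIntVec c.m (callRun B c.W c.R (c.query r) (r.drop (c.len1 + c.len2))))

/-- **The candidate `u = x − ∑ zᵢ yᵢ`.** [cite: MicciancioRegev2007, Thm. 5.9 (step 4)] -/
def uOut (B : RandAlg (List Bool) (List Bool)) (r : List Bool) : List ℤ := c.d.uVecL (c.Ks r) (c.kappas r) (c.zAns B r)

/-- **The output of the attempt**: the coefficient row `B_U u/Dg` as a row code. [cite: MicciancioRegev2007, Thm. 5.9 (output s)] -/
def runOut (B : RandAlg (List Bool) (List Bool)) (r : List Bool) : List Bool := rawE intE (edivL (mulVecL c.d.Brows (c.uOut B r)) c.d.Dg)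

end RunCtx

/-! ### The context from the instance and the guess -/

/-- The guess `α` from its natural code: `a < β̂ ↦ a + 1`, `a ≥ β̂ ↦ −(a − β̂ + 1)`. [cite: MicciancioRegev2007, Thm. 5.9 (step 1)] -/
def alphaOfNat (βh a : ℕ) : ℤ := if a < βh then ((a + 1 : ℕ) : ℤ) else -(((a - βh + 1 : ℕ) : ℤ))

/-- The precision of the sampler: `80 + size (p n)` (`Peikert2009.Spec.prec (p n)`). [folklore] -/
def precOf (p : Polynomial ℕ) (n : ℕ) : ℕ := 80 + Nat.size (p.eval n)

section Ctx

variable (qf mf βhat : ℕ → ℕ) (pS pB : Polynomial ℕ) (J : IncGDDInst) (i : ℕ)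

/-- The guess `α` read off the guess index. [cite: MicciancioRegev2007, Thm. 5.9 (step 1)] -/
def alphaOfJ : ℤ := alphaOfNat (βhat J.n) (i % (2 * βhat J.n))

/-- The guessed position `j₀` read off the guess index. [cite: MicciancioRegev2007, Thm. 5.9 (step 1)] -/
def j0OfJ : ℕ := i / (2 * βhat J.n)

/-- **The scaling factor `c = invDen(U)^{2n−2}`** (`= c_U` on a well-formed instance). [cite: Cohen1993, §2.6.3] -/
def ccOfJ : ℤ := invDen J.U ^ (2 * J.n - 2)

/-- **The rows of `B_U = invMatrix Uᵀ`** (Cohen's inverse columns of `Uᵀ`, transposed). [cite: Cohen1993, §2.6.3] -/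
def BrowsOfJ : List (List ℤ) := transposeL J.n (invCols (transposeL J.n J.U))

/-- `Dg = invDen (rows of B_U)`. [cite: Cohen1993, §2.6.3] -/
def DgOfJ : ℤ := invDen (BrowsOfJ J)

/-- `N₁ = N₂ rd (β̂ + 1) n`. [folklore] -/
def N1OfJ : ℕ := N2Of (qf J.n) J.n * J.rd * (βhat J.n + 1) * J.n

/-- The grid `N = N₁ |α| td`. [folklore] -/
def NOfJ : ℕ := N1OfJ qf βhat J * (alphaOfJ βhat J i).natAbs * J.td

/-- The scaled rows `c · V`. [cite: MicciancioRegev2007, Thm. 5.9 (input S)] -/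
def SrowsOfJ : List (List ℤ) := J.V.map (smulL (ccOfJ J))

/-- The rows of `T_S` (the `τⱼ = B_U sⱼ/Dg`, transposed). [cite: MicciancioRegev2007, Lemma 5.8 (S-coordinates)] -/
def TSrowsOfJ : List (List ℤ) := transposeL J.n ((SrowsOfJ J).map fun s => edivL (mulVecL (BrowsOfJ J) s) (DgOfJ J))

/-- `dT = invDen (rows of T_S)`. [folklore] -/
def dTOfJ : ℤ := invDen (TSrowsOfJ J)

/-- **The list data of the model on `B_U`** computed from `(J, i)`. [cite: MicciancioRegev2007, Thm. 5.9 (steps 2–4)] -/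
def attDataOfJ : AttData :=
  ⟨J.n, BrowsOfJ J, invCols (BrowsOfJ J), DgOfJ J, NOfJ qf βhat J i, SrowsOfJ J, invCols (TSrowsOfJ J),
    dTOfJ J * ((NOfJ qf βhat J i : ℤ) * DgOfJ J), qf J.n⟩

/-- `X = c rn N₂ |α| td`. [folklore] -/
def XOfJ : ℕ := (ccOfJ J).toNat * J.rn * N2Of (qf J.n) J.n * (alphaOfJ βhat J i).natAbs * J.td

/-- The mesh exponent `b = log₂ X`. [folklore] -/
def bOfJ : ℕ := Nat.log 2 (XOfJ qf βhat J i)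

/-- The sampler `std (precOf p n) b`. [folklore] -/
def POfJ : PGParams := PGParams.std (precOf pS J.n) (bOfJ qf βhat J i)

/-- The box length `size dT + size n + n`. [folklore] -/
def ellOfJ : ℕ := Nat.size (dTOfJ J).toNat + Nat.size J.n + J.n

/-- The coin supply of the call `R = pB(matBound n m q)`. [cite: Goldreich2001, §1.3.2] -/
def ROfJ : ℕ := pB.eval (SIS.matBound J.n (mf J.n) (qf J.n))

/-- The shift row of the guessed sample `−(sign α · c · N₁) · tw`. [cite: MicciancioRegev2007, Thm. 5.9 (step 2)] -/
def TshOfJ : List ℤ := smulL (-(Int.sign (alphaOfJ βhat J i) * ccOfJ J * N1OfJ qf βhat J)) J.tw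

/-- **The static data computed from `(J, i)`** (exact integer arithmetic throughout).
[cite: MicciancioRegev2007, Thm. 5.9 (steps 1–2); Cohen1993, §2.6.3] -/
def ctxOf : RunCtx :=
  ⟨attDataOfJ qf βhat J i, mf J.n, j0OfJ βhat J i, TshOfJ qf βhat J i, POfJ qf βhat pS J i, ellOfJ J,
    Nat.size (ROfJ qf mf pB J), ROfJ qf mf pB J⟩

end Ctx

/-! ### Agreement: the guess -/

/-- `alphaOfNat` is `alphaOf` on codes in range. [folklore] -/
theorem alphaOfNat_eq {βh : ℕ} (a : Fin (2 * βh)) : alphaOfNat βh a = alphaOf βh a := rfl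

/-- The position is recovered from the guess index. [folklore] -/
theorem guessIdx_div {βh : ℕ} (j₀ : ℕ) (a : Fin (2 * βh)) : guessIdx βh j₀ a / (2 * βh) = j₀ := by
  have h : 0 < 2 * βh := by have := a.2; omega
  rw [guessIdx, Nat.add_comm, Nat.add_mul_div_right _ _ h, Nat.div_eq_of_lt a.2, zero_add]

/-- The guess code is recovered from the guess index. [folklore] -/
theorem guessIdx_mod {βh : ℕ} (j₀ : ℕ) (a : Fin (2 * βh)) : guessIdx βh j₀ a % (2 * βh) = a := by
  rw [guessIdx, Nat.add_comm, Nat.add_mul_mod_self_right, Nat.mod_eq_of_lt a.2]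

/-! ### Agreement: the list matrices -/

/-- Transposing the rows of a well-formed list matrix gives the rows of the transpose. [folklore] -/
theorem transposeL_eq_rowsOf_transpose {n : ℕ} {U : List (List ℤ)} (hlen : U.length = n) :
    transposeL n U = rowsOf (toMat n n U).transpose := by
  refine List.ext_getElem (by simp [rowsOf]) fun t h1 h2 => ?_
  simp only [transposeL, List.getElem_map, List.getElem_range]
  rw [getElem_rowsOf]
  refine List.ext_getElem (by simp [hlen]) fun j h3 h4 => ?_
  have hj : j < U.length := by simpa using h3
  rw [List.getElem_map, List.getElem_ofFn]
  simp only [Matrix.transpose_apply, toMat, ent]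
  rw [List.getD_eq_getElem U [] hj]

/-- The columns of Cohen's inverse, transposed, are the rows of `invMatrix`. [cite: Cohen1993, §2.6.3] -/
theorem transposeL_invCols_eq_rowsOf_invMatrix {n : ℕ} (T : Matrix (Fin n) (Fin n) ℤ) :
    transposeL n (invCols (rowsOf T)) = rowsOf (invMatrix T) := by
  refine List.ext_getElem (by simp [rowsOf]) fun t h1 h2 => ?_
  simp only [transposeL, List.getElem_map, List.getElem_range]
  rw [getElem_rowsOf]
  refine List.ext_getElem (by simp) fun k h3 h4 => ?_
  rw [List.getElem_map, List.getElem_ofFn, getElem_invCols, invMatrix_apply]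

variable {J : IncGDDInst}

/-- The rows of `B_U` from the wire rows of `U`. [cite: Cohen1993, §2.6.3] -/
theorem Brows_eq (hJ : J.WellFormed) : transposeL J.n (invCols (transposeL J.n J.U)) = rowsOf (BU (Umat J)) := by
  rw [transposeL_eq_rowsOf_transpose hJ.len_U, transposeL_invCols_eq_rowsOf_invMatrix]; rfl

/-- **`invDen(U)^{2n−2} = c_U`** on a well-formed instance. [cite: Cohen1993, §2.6.3] -/
theorem invDen_pow_eq_cU (hJ : J.WellFormed) : invDen J.U ^ (2 * J.n - 2) = cU (Umat J) := by
  have h : J.U = rowsOf (Umat J) := (rowsOf_toMat hJ.len_U hJ.row_U).symm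
  rw [h, invDen_eq_det_sq (det_Umat_ne hJ), ← pow_mul, cU]
  congr 1; omega

/-- The scaled wire rows are the rows of `S' = c·V`. [folklore] -/
theorem Srows_eq (hJ : J.WellFormed) : J.V.map (smulL (cU (Umat J))) = rowsOf (Smod J : Matrix (Fin J.n) (Fin J.n) ℤ) := by
  have hV : J.V = rowsOf (toMat J.n J.n J.V) := (rowsOf_toMat hJ.len_V hJ.row_V).symm
  rw [hV, rowsOf_eq_ofFn, List.map_ofFn, rowsOf_eq_ofFn]
  congr 1; funext j
  rw [Function.comp_apply, smulL_vecL]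
  rfl

/-- The `τ`-rows transposed are the rows of `T_S`. [cite: MicciancioRegev2007, Lemma 5.8 (S-coordinates)] -/
theorem TSrows_eq {n : ℕ} (B : Matrix (Fin n) (Fin n) ℤ) (S : Matrix (Fin n) (Fin n) ℤ) :
    transposeL n ((rowsOf S).map fun s => edivL (mulVecL (rowsOf B) s) (invDen (rowsOf B))) = rowsOf (TS B S) := by
  have h : ((rowsOf S).map fun s => edivL (mulVecL (rowsOf B) s) (invDen (rowsOf B))) = List.ofFn fun j => vecL (tauVec B S j) := by
    rw [show rowsOf S = List.ofFn (fun j => vecL (S j)) from rfl, List.map_ofFn]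
    congr 1; funext j
    rw [Function.comp_apply, mulVecL_rowsOf, edivL_vecL]; rfl
  rw [h, transposeL_ofFn]; rfl

section CtxAgreement

variable {qf mf βhat : ℕ → ℕ} {pS pB : Polynomial ℕ} {J : IncGDDInst}

/-- **The machine's `AttData` is the faithful list data of the model** `(B_U, N, c·V, q)`.
[cite: MicciancioRegev2007, Thm. 5.9 (steps 2–4)] -/
theorem ctxOf_d (hJ : J.WellFormed) (j₀ : ℕ) (a : Fin (2 * βhat J.n)) :
    (ctxOf qf mf βhat pS pB J (guessIdx (βhat J.n) j₀ a)).d =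
      attDataOf (BU (Umat J)) (NOf J (alphaOf (βhat J.n) a) (N1Of J (qf J.n) (βhat J.n + 1))) (Smod J : Matrix (Fin J.n) (Fin J.n) ℤ)
        (qf J.n) := by
  simp only [ctxOf, attDataOfJ, NOfJ, N1OfJ, alphaOfJ, BrowsOfJ, DgOfJ, SrowsOfJ, TSrowsOfJ, dTOfJ, ccOfJ, guessIdx_mod, alphaOfNat_eq,
    invDen_pow_eq_cU hJ, Brows_eq hJ, Srows_eq hJ, TSrows_eq, attDataOf, NOf, N1Of]
  rfl

/-- The machine's shift row is the shift of sample `j₀`. [cite: MicciancioRegev2007, Thm. 5.9 (step 2)] -/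
theorem ctxOf_Tsh (hJ : J.WellFormed) {j₀ : ℕ} (hj : j₀ < mf J.n) (a : Fin (2 * βhat J.n)) :
    (ctxOf qf mf βhat pS pB J (guessIdx (βhat J.n) j₀ a)).Tsh =
      vecL (TshOf J (mf J.n) ⟨j₀, hj⟩ (alphaOf (βhat J.n) a) (N1Of J (qf J.n) (βhat J.n + 1)) ⟨j₀, hj⟩) := by
  simp only [ctxOf, TshOfJ, alphaOfJ, ccOfJ, N1OfJ, guessIdx_mod, alphaOfNat_eq, invDen_pow_eq_cU hJ]
  refine list_eq_of_getD (n := J.n) (by simp [hJ.len_tw]) (by simp) fun t => ?_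
  rw [getD_vecL, TshOf, if_pos rfl, smulL, List.getD_eq_getElem _ _ (by simp [hJ.len_tw]), List.getElem_map,
    List.getD_eq_getElem _ _ (by simp [hJ.len_tw]), N1Of]

/-- The machine's other fields. [folklore] -/
theorem ctxOf_fields (J : IncGDDInst) (j₀ : ℕ) (a : Fin (2 * βhat J.n)) :
    (ctxOf qf mf βhat pS pB J (guessIdx (βhat J.n) j₀ a)).m = mf J.n ∧
    (ctxOf qf mf βhat pS pB J (guessIdx (βhat J.n) j₀ a)).j₀ = j₀ ∧
    (ctxOf qf mf βhat pS pB J (guessIdx (βhat J.n) j₀ a)).R = pB.eval (SIS.matBound J.n (mf J.n) (qf J.n)) ∧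
    (ctxOf qf mf βhat pS pB J (guessIdx (βhat J.n) j₀ a)).W = Nat.size (pB.eval (SIS.matBound J.n (mf J.n) (qf J.n))) := by
  refine ⟨?_, ?_, ?_, ?_⟩ <;> simp only [ctxOf, j0OfJ, ROfJ, guessIdx_div]

/-- The machine's sampler is `std (precOf p n) b` with the mesh exponent of the model. [folklore] -/
theorem ctxOf_P (hJ : J.WellFormed) (j₀ : ℕ) (a : Fin (2 * βhat J.n)) :
    (ctxOf qf mf βhat pS pB J (guessIdx (βhat J.n) j₀ a)).P = PGParams.std (precOf pS J.n) (bOf J (qf J.n) (alphaOf (βhat J.n) a)) := by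
  simp only [ctxOf, POfJ, bOfJ, XOfJ, alphaOfJ, ccOfJ, guessIdx_mod, alphaOfNat_eq, invDen_pow_eq_cU hJ, bOf, XOf]

/-- The machine's box length is `ellOf J`. [folklore] -/
theorem ctxOf_ell (hJ : J.WellFormed) (j₀ : ℕ) (a : Fin (2 * βhat J.n)) :
    (ctxOf qf mf βhat pS pB J (guessIdx (βhat J.n) j₀ a)).ℓ = ellOf J := by
  simp only [ctxOf, ellOfJ, dTOfJ, TSrowsOfJ, SrowsOfJ, BrowsOfJ, DgOfJ, ccOfJ, invDen_pow_eq_cU hJ, Brows_eq hJ, Srows_eq hJ, TSrows_eq,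
    ellOf, dT]

end CtxAgreement

/-! ### Agreement: the query string and the output -/

/-- The rows of residues read off faithful query columns are the rows of `vals` of the model's matrix.
[cite: MicciancioRegev2007, Def. 5.3] -/
theorem valRows_eq_of_aRows {c : RunCtx} {r : List Bool} {q : ℕ} [NeZero q]
    {A : Matrix (Fin c.d.n) (Fin c.m) (ZMod q)} {acol : Fin c.m → Fin c.d.n → ℤ}
    (hA : ∀ j i, A j i = ((acol i j : ℤ) : ZMod q)) (hrange : ∀ i j, 0 ≤ acol i j ∧ acol i j < q)
    (hrows : c.aRows r = List.ofFn fun i => vecL (acol i)) :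
    c.valRows r = List.ofFn fun j => List.ofFn fun i => (A j i).val := by
  refine List.ext_getElem (by simp [RunCtx.valRows]) fun j h1 h2 => ?_
  have hj : j < c.d.n := by simpa [RunCtx.valRows] using h1
  simp only [RunCtx.valRows, List.getElem_map, List.getElem_range, hrows, List.map_ofFn, List.getElem_ofFn]
  congr 1; funext i
  rw [Function.comp_apply, getD_vecL_nat _ hj, hA ⟨j, hj⟩ i]
  obtain ⟨h0, hlt⟩ := hrange i ⟨j, hj⟩
  have hv : ((((acol i ⟨j, hj⟩ : ℤ) : ZMod q)).val : ℤ) = acol i ⟨j, hj⟩ := by rw [ZMod.val_intCast, Int.emod_eq_of_lt h0 hlt]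
  have ht : ((acol i ⟨j, hj⟩).toNat : ℤ) = acol i ⟨j, hj⟩ := Int.toNat_of_nonneg h0
  exact_mod_cast ht.trans hv.symm

/-- **The query string is `encodeMatrix A`** for the matrix read off faithful columns.
[cite: MicciancioRegev2007, Def. 5.3 (the instance (q, A))] -/
theorem query_eq_encodeMatrix {c : RunCtx} {r : List Bool} {q : ℕ} [NeZero q] (hq : c.d.q = q)
    {A : Matrix (Fin c.d.n) (Fin c.m) (ZMod q)} {acol : Fin c.m → Fin c.d.n → ℤ}
    (hA : ∀ j i, A j i = ((acol i j : ℤ) : ZMod q)) (hrange : ∀ i j, 0 ≤ acol i j ∧ acol i j < q)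
    (hrows : c.aRows r = List.ofFn fun i => vecL (acol i)) :
    c.query r = SIS.encodeMatrix A := by
  rw [RunCtx.query, valRows_eq_of_aRows hA hrange hrows, hq, SIS.encodeMatrix]
  have he : (encodingFinVec (encodingFinVec Computability.encodingNatBool c.m) c.d.n).encode (fun j i => (A j i).val) =
      listE (listE natE) (List.ofFn fun j => List.ofFn fun i => (A j i).val) := by
    change (encodingFinVec Computability.encodingNatBool c.m).listBool.encode (List.ofFn fun j i => (A j i).val) = _
    rw [listE_eq]
    change listE (fun v : Fin c.m → ℕ => Computability.encodingNatBool.listBool.encode (List.ofFn v)) (List.ofFn fun j i => (A j i).val) = _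
    rw [listE_eq]
    simp only [listE, rawE, List.map_ofFn, List.length_ofFn, Function.comp_def]
    rfl
  rw [he]
  rfl

/-- **The output on faithful noises, boxes and answer is `rawE intE (zOf J u)`** for the model's `u = uVec`.
[cite: MicciancioRegev2007, Thm. 5.9 (step 4)] -/
theorem runOut_eq_of_faithful {J : IncGDDInst} {c : RunCtx} {N q m : ℕ}
    (hd : c.d = attDataOf (BU (Umat J)) N (Smod J : Matrix (Fin J.n) (Fin J.n) ℤ) q) (B : RandAlg (List Bool) (List Bool))
    {r : List Bool} {Kf κf : Fin m → Fin J.n → ℤ} {z : Fin m → ℤ}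
    (hK : c.Ks r = List.ofFn fun i => vecL (Kf i)) (hκ : c.kappas r = List.ofFn fun i => vecL (κf i)) (hz : c.zAns B r = vecL z) :
    c.runOut B r = rawE intE (zOf J (uVec (BU (Umat J)) N (Smod J) q Kf κf z)) := by
  rw [RunCtx.runOut, RunCtx.uOut, hK, hκ, hz, hd, uVecL_eq]
  simp only [attDataOf]
  rw [mulVecL_rowsOf, edivL_vecL]
  rfl

/-! ## The coin law of the run -/

/-! ### Uniform strings: splitting in `bind` form, words as numbers -/

/-- **A uniform string split at `a`** is a uniform prefix and, independently, a uniform rest.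
[cite: AroraBarak2009, Def. 7.1] -/
theorem uniformVector_bind_split {β : Type*} {a C : ℕ} (h : a ≤ C) (f : List.Vector Bool a → List.Vector Bool (C - a) → PMF β) :
    ((uniformOfFintype (List.Vector Bool C)).bind fun r => f (vecSplit a C h r).1 (vecSplit a C h r).2) =
      (uniformOfFintype (List.Vector Bool a)).bind fun u => (uniformOfFintype (List.Vector Bool (C - a))).bind fun v => f u v := by
  have h1 : ((uniformOfFintype (List.Vector Bool C)).bind fun r => f (vecSplit a C h r).1 (vecSplit a C h r).2) =
      ((uniformOfFintype (List.Vector Bool C)).map (vecSplit a C h)).bind fun p => f p.1 p.2 := by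
    rw [PMF.bind_map]; rfl
  rw [h1, uniformVector_map_vecSplit, uniformOfFintype_prod_eq_bind, PMF.bind_bind]
  refine congrArg _ (funext fun u => ?_)
  rw [PMF.bind_map]; rfl

/-- The value of an `ℓ`-bit word as an element of `Fin (2^ℓ)`. [folklore] -/
def bitsFin {ℓ : ℕ} (w : List.Vector Bool ℓ) : Fin (2 ^ ℓ) := ⟨bitsToNat w.toList, by simpa using bitsToNat_lt w.toList⟩

/-- `bitsFin` is a bijection. [folklore] -/
theorem bitsFin_bijective (ℓ : ℕ) : Function.Bijective (bitsFin (ℓ := ℓ)) := by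
  rw [Fintype.bijective_iff_surjective_and_card]
  refine ⟨fun x => ⟨⟨Literature.Computability.Complexity.natBits ℓ x, Literature.Computability.Complexity.length_natBits ℓ x⟩,
    Fin.ext (Literature.Computability.Complexity.bitsToNat_natBits x.2)⟩, by simp [card_vector]⟩

/-- **An `ℓ`-bit word of a uniform string is uniform on `[0, 2^ℓ)`.** [cite: AroraBarak2009, Def. 7.1] -/
theorem uniformVector_map_bitsFin (ℓ : ℕ) : (uniformOfFintype (List.Vector Bool ℓ)).map bitsFin = uniformOfFintype (Fin (2 ^ ℓ)) :=
  uniformOfFintype_map_equiv (Equiv.ofBijective _ (bitsFin_bijective ℓ))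

/-! ### The run reads three segments -/

section Segments

variable (c : RunCtx) (B : RandAlg (List Bool) (List Bool))

/-- **The run as a function of its three coin segments** (noises, boxes, call). [cite: MicciancioRegev2007, Thm. 5.9 (steps 2–4)] -/
def runSeg (s₁ s₂ s₃ : List Bool) : List Bool :=
  let Ks := (((blocksOf c.P.coinLen c.d.n c.m s₁).map fun ws => ws.map c.P.samplerFlat).mapIdx fun i X =>
    if i = c.j₀ then addL X c.Tsh else X)
  let κs := (blocksOf c.ℓ c.d.n c.m s₂).map fun ws => ws.map fun w => (Literature.Computability.Complexity.bitsToNat w : ℤ)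
  let aRows := c.d.aRowsL Ks κs
  let query := pairE natE (pairE natE (pairE natE (listE (listE natE))))
    (c.d.n, (c.m, (c.d.q, (List.range c.d.n).map fun j => aRows.map fun col => (col.getD j 0).toNat)))
  let z := vecL (decodeIntVec c.m (callRun B c.W c.R query s₃))
  rawE intE (edivL (mulVecL c.d.Brows (c.d.uVecL Ks κs z)) c.d.Dg)

/-- The run reads the segments `r[0, len1)`, `r[len1, len1 + len2)`, `r[len1 + len2, …)`. [folklore] -/
theorem runOut_eq_runSeg (r : List Bool) :
    c.runOut B r = runSeg c B (r.take c.len1) ((r.drop c.len1).take c.len2) (r.drop (c.len1 + c.len2)) := rfl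

/-- The call reads only `W + R` coins of its segment. [folklore] -/
theorem runSeg_take (s₁ s₂ s₃ : List Bool) : runSeg c B s₁ s₂ (s₃.take (c.W + c.R)) = runSeg c B s₁ s₂ s₃ := by
  simp only [runSeg, callRun_take]

/-- On a string of length `≥ coinTotal` the three segments are the nested splits. [folklore] -/
theorem runOut_eq_runSeg_split {C : ℕ} (hC : c.coinTotal ≤ C) (r : List.Vector Bool C) :
    c.runOut B r.toList =
      runSeg c B (vecSplit c.len1 C (by unfold RunCtx.coinTotal at hC; omega) r).1.toList
        (vecSplit c.len2 (C - c.len1) (by unfold RunCtx.coinTotal at hC; omega) (vecSplit c.len1 C (by unfold RunCtx.coinTotal at hC; omega) r).2).1.toList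
        (vecSplit (c.W + c.R) (C - c.len1 - c.len2) (by unfold RunCtx.coinTotal at hC; omega)
          (vecSplit c.len2 (C - c.len1) (by unfold RunCtx.coinTotal at hC; omega)
            (vecSplit c.len1 C (by unfold RunCtx.coinTotal at hC; omega) r).2).2).1.toList := by
  rw [runOut_eq_runSeg]
  change runSeg c B (r.toList.take c.len1) ((r.toList.drop c.len1).take c.len2) (r.toList.drop (c.len1 + c.len2)) =
    runSeg c B (r.toList.take c.len1) ((r.toList.drop c.len1).take c.len2) (((r.toList.drop c.len1).drop c.len2).take (c.W + c.R))
  rw [List.drop_drop, runSeg_take]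

end Segments

/-! ### The laws of the segments -/

section Laws

variable (c : RunCtx)

/-- **The noises as `Fin`-indexed vectors**: coordinate `t` of sample `i` is the flat sampler on word `t` of
block `i`, shifted by `Tsh` at `i = j₀`. [cite: MicciancioRegev2007, Thm. 5.9 (step 2)] -/
def noiseOf (T₀ : Fin c.d.n → ℤ) (s₁ : List Bool) (i : Fin c.m) : Fin c.d.n → ℤ :=
  fun t => c.P.samplerFlat (chunk c.P.coinLen (chunk (c.P.coinLen * c.d.n) s₁ i) t) + (if (i : ℕ) = c.j₀ then T₀ t else 0)

/-- **The boxes as `Fin`-indexed vectors.** [folklore] -/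
def boxOf (s₂ : List Bool) (i : Fin c.m) : Fin c.d.n → ℤ :=
  fun t => (Literature.Computability.Complexity.bitsToNat (chunk c.ℓ (chunk (c.ℓ * c.d.n) s₂ i) t) : ℤ)

variable {c}

/-- `(range k).map f = ofFn`. [folklore] -/
theorem map_range_eq_ofFn {α : Type*} (k : ℕ) (f : ℕ → α) : (List.range k).map f = List.ofFn fun i : Fin k => f i := by
  refine List.ext_getElem (by simp) fun i h1 h2 => ?_
  simp

/-- The list noises are the faithful lists of `noiseOf`. [folklore] -/
theorem Ks_eq_ofFn {T₀ : Fin c.d.n → ℤ} (hT : c.Tsh = vecL T₀) (s₁ : List Bool) :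
    ((((blocksOf c.P.coinLen c.d.n c.m s₁).map fun ws => ws.map c.P.samplerFlat).mapIdx fun i X =>
        if i = c.j₀ then addL X c.Tsh else X)) = List.ofFn fun i => vecL (noiseOf c T₀ s₁ i) := by
  refine List.ext_getElem (by simp [blocksOf]) fun i h1 h2 => ?_
  have hi : i < c.m := by simpa using h2
  rw [List.getElem_mapIdx, List.getElem_map, List.getElem_ofFn]
  simp only [blocksOf, List.getElem_map, List.getElem_range, List.map_map]
  have hX : List.map (c.P.samplerFlat ∘ fun l => chunk c.P.coinLen (chunk (c.P.coinLen * c.d.n) s₁ i) l) (List.range c.d.n) =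
      vecL fun t : Fin c.d.n => c.P.samplerFlat (chunk c.P.coinLen (chunk (c.P.coinLen * c.d.n) s₁ i) t) := map_range_eq_ofFn _ _
  rw [hX]
  split_ifs with hij
  · rw [hT, addL_vecL]
    congr 1; funext t; simp [noiseOf, hij]
  · congr 1; funext t; simp [noiseOf, hij]

/-- The list boxes are the faithful lists of `boxOf`. [folklore] -/
theorem kappas_eq_ofFn (s₂ : List Bool) :
    ((blocksOf c.ℓ c.d.n c.m s₂).map fun ws => ws.map fun w => (Literature.Computability.Complexity.bitsToNat w : ℤ)) =
      List.ofFn fun i => vecL (boxOf c s₂ i) := by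
  refine List.ext_getElem (by simp [blocksOf]) fun i h1 h2 => ?_
  rw [List.getElem_map, List.getElem_ofFn]
  simp only [blocksOf, List.getElem_map, List.getElem_range, List.map_map]
  exact map_range_eq_ofFn _ _

/-- **The law of the noises**: `⨂ᵢ gridNoiseWith ℓ'_P (Tsh i)`. [cite: MicciancioRegev2007, Lemma 5.7 (fine-grid form) with Thm. 5.9 (step 2)] -/
theorem map_noiseSeg_eq (T₀ : Fin c.d.n → ℤ) :
    (uniformOfFintype (List.Vector Bool c.len1)).map (fun s => noiseOf c T₀ s.toList) =
      indepLaw c.m fun i => gridNoiseWith c.P.lawPMF (if (i : ℕ) = c.j₀ then T₀ else 0) := by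
  have hlen : c.P.coinLen * c.d.n * c.m ≤ c.len1 := by unfold RunCtx.len1; exact le_of_eq (by ring)
  have hblk : c.P.coinLen * c.d.n ≤ c.P.coinLen * c.d.n := le_rfl
  -- the noises factor through the blocks
  have hfac : (fun s : List.Vector Bool c.len1 => noiseOf c T₀ s.toList) =
      (fun X : Fin c.m → (Fin c.d.n → ℤ) => fun i => X i + (if (i : ℕ) = c.j₀ then T₀ else 0)) ∘
        (fun blk : Fin c.m → List.Vector Bool (c.P.coinLen * c.d.n) => fun i => PGParams.samplerVec c.P c.d.n hblk (blk i)) ∘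
        chunks (c.P.coinLen * c.d.n) c.m hlen := by
    funext s
    funext i t
    simp only [Function.comp_apply, noiseOf, Pi.add_apply, PGParams.samplerVec, toList_chunks]
    by_cases h : (i : ℕ) = c.j₀ <;> simp [h]
  rw [hfac, ← PMF.map_comp, ← PMF.map_comp, uniformVector_map_chunks_eq_indepLaw,
    indepLaw_map_pi c.m _ (fun _ blk => PGParams.samplerVec c.P c.d.n hblk blk)]
  simp only [PGParams.uniformVector_map_samplerVec_eq_indepLaw]
  rw [indepLaw_map_pi c.m _ (fun i X => X + (if (i : ℕ) = c.j₀ then T₀ else 0))]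
  rfl

/-- **The law of the boxes**: `⨂ᵢ boxLaw n ℓ`. [folklore] -/
theorem map_boxSeg_eq :
    (uniformOfFintype (List.Vector Bool c.len2)).map (fun s => boxOf c s.toList) = indepLaw c.m fun _ => boxLaw c.d.n c.ℓ := by
  have hlen : c.ℓ * c.d.n * c.m ≤ c.len2 := by unfold RunCtx.len2; exact le_of_eq (by ring)
  have hblk : c.ℓ * c.d.n ≤ c.ℓ * c.d.n := le_rfl
  have hfac : (fun s : List.Vector Bool c.len2 => boxOf c s.toList) =
      (fun blk : Fin c.m → List.Vector Bool (c.ℓ * c.d.n) => fun i => fun t => (((bitsFin (chunks c.ℓ c.d.n hblk (blk i) t)) : ℕ) : ℤ)) ∘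
        chunks (c.ℓ * c.d.n) c.m hlen := by
    funext s; funext i t
    simp only [Function.comp_apply, boxOf, bitsFin, toList_chunks]
  rw [hfac, ← PMF.map_comp, uniformVector_map_chunks_eq_indepLaw,
    indepLaw_map_pi c.m _ (fun _ blk => fun t => (((bitsFin (chunks c.ℓ c.d.n hblk blk t)) : ℕ) : ℤ))]
  congr 1; funext i
  -- one block: words → `Fin (2^ℓ)` coordinates → integers
  have h1 : (fun blk : List.Vector Bool (c.ℓ * c.d.n) => fun t => (((bitsFin (chunks c.ℓ c.d.n hblk blk t)) : ℕ) : ℤ)) =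
      (fun x : Fin c.d.n → Fin (2 ^ c.ℓ) => fun t => ((x t : ℕ) : ℤ)) ∘ (fun w : Fin c.d.n → List.Vector Bool c.ℓ => fun t => bitsFin (w t)) ∘
        chunks c.ℓ c.d.n hblk := by
    funext blk; rfl
  rw [h1, ← PMF.map_comp, ← PMF.map_comp, uniformVector_map_chunks_eq_indepLaw,
    Literature.Probability.Distributions.indepLaw_uniformOfFintype, uniformPi_map_eq_indepLaw c.d.n (bitsFin (ℓ := c.ℓ))]
  simp only [uniformVector_map_bitsFin]
  rw [Literature.Probability.Distributions.indepLaw_uniformOfFintype, boxLaw]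

/-- **The law of the answer**: the kernel of the guessed-coin call read by the decoder. [cite: Goldreich2001, §1.3.2] -/
theorem map_callSeg_eq (B : RandAlg (List Bool) (List Bool)) (x : List Bool) :
    (uniformOfFintype (List.Vector Bool (c.W + c.R))).map (fun s => decodeIntVec c.m (callRun B c.W c.R x s.toList)) =
      (callLaw B c.W c.R x).map (decodeIntVec c.m) := by
  rw [callLaw, PMF.map_comp]; rfl

end Laws

/-! ### The law of the run -/

section Main

variable {c : RunCtx} {q N : ℕ} [NeZero q] {B' : Matrix (Fin c.d.n) (Fin c.d.n) ℤ} {S : Matrix (Fin c.d.n) (Fin c.d.n) ℤ}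

/-- `0 ≤ aEnt < q`. [folklore] -/
theorem aEnt_range (K κ : Fin c.d.n → ℤ) (j : Fin c.d.n) : 0 ≤ aEnt B' N S q K κ j ∧ aEnt B' N S q K κ j < q := by
  have hq : (0 : ℤ) < q := by exact_mod_cast Nat.pos_of_ne_zero (NeZero.ne q)
  exact ⟨Int.emod_nonneg _ hq.ne', Int.emod_lt_of_pos _ hq⟩

/-- **The run on three segments is the model's output map applied to the model's quantities.**
[cite: MicciancioRegev2007, Thm. 5.9 (steps 2–4)] -/
theorem runSeg_eq_model (hd : c.d = attDataOf B' N S q) {T₀ : Fin c.d.n → ℤ} (hT : c.Tsh = vecL T₀)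
    (B : RandAlg (List Bool) (List Bool)) (s₁ s₂ s₃ : List Bool) :
    runSeg c B s₁ s₂ s₃ =
      rawE intE (edivL (mulVecL (rowsOf B')
        (vecL (uVec B' N S q (noiseOf c T₀ s₁) (boxOf c s₂)
          (decodeIntVec c.m (callRun B c.W c.R (SIS.encodeMatrix (Amat B' N S q (noiseOf c T₀ s₁) (boxOf c s₂))) s₃))))) (Dg B')) := by
  have hK := Ks_eq_ofFn hT s₁
  have hκ := kappas_eq_ofFn (c := c) s₂
  -- the fields of the faithful data
  have hA : c.d.aRowsL = (attDataOf B' N S q).aRowsL := congrArg AttData.aRowsL hd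
  have hU : c.d.uVecL = (attDataOf B' N S q).uVecL := congrArg AttData.uVecL hd
  have hBr : c.d.Brows = rowsOf B' := congrArg AttData.Brows hd
  have hDg : c.d.Dg = Dg B' := congrArg AttData.Dg hd
  have hq : c.d.q = q := congrArg AttData.q hd
  -- the query columns and the query string
  have hrows : c.d.aRowsL (List.ofFn fun i => vecL (noiseOf c T₀ s₁ i)) (List.ofFn fun i => vecL (boxOf c s₂ i)) =
      List.ofFn fun i => vecL fun j => aEnt B' N S q (noiseOf c T₀ s₁ i) (boxOf c s₂ i) j := by
    rw [hA]; exact aRowsL_eq B' N S q _ _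
  have hquery : pairE natE (pairE natE (pairE natE (listE (listE natE))))
      (c.d.n, (c.m, (c.d.q, (List.range c.d.n).map fun j =>
        (c.d.aRowsL (List.ofFn fun i => vecL (noiseOf c T₀ s₁ i)) (List.ofFn fun i => vecL (boxOf c s₂ i))).map fun col =>
          (col.getD j 0).toNat))) = SIS.encodeMatrix (Amat B' N S q (noiseOf c T₀ s₁) (boxOf c s₂)) := by
    rw [hrows]
    have hval : ((List.range c.d.n).map fun j => (List.ofFn fun i => vecL fun j => aEnt B' N S q (noiseOf c T₀ s₁ i) (boxOf c s₂ i) j).map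
        fun col => (col.getD j 0).toNat) =
        List.ofFn fun j => List.ofFn fun i => ((Amat B' N S q (noiseOf c T₀ s₁) (boxOf c s₂)) j i).val := by
      rw [map_range_eq_ofFn]
      congr 1; funext j
      rw [List.map_ofFn]
      congr 1; funext i
      rw [Function.comp_apply, getD_vecL, Amat, Matrix.of_apply]
      obtain ⟨h0, hlt⟩ := aEnt_range (c := c) (q := q) (N := N) (B' := B') (S := S) (noiseOf c T₀ s₁ i) (boxOf c s₂ i) j
      have hv : ((((aEnt B' N S q (noiseOf c T₀ s₁ i) (boxOf c s₂ i) j : ℤ) : ZMod q)).val : ℤ) = aEnt B' N S q (noiseOf c T₀ s₁ i) (boxOf c s₂ i) j := by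
        rw [ZMod.val_intCast, Int.emod_eq_of_lt h0 hlt]
      have ht : ((aEnt B' N S q (noiseOf c T₀ s₁ i) (boxOf c s₂ i) j).toNat : ℤ) = aEnt B' N S q (noiseOf c T₀ s₁ i) (boxOf c s₂ i) j :=
        Int.toNat_of_nonneg h0
      exact_mod_cast ht.trans hv.symm
    rw [hval, hq, SIS.encodeMatrix]
    have he : (encodingFinVec (encodingFinVec Computability.encodingNatBool c.m) c.d.n).encode
        (fun j i => ((Amat B' N S q (noiseOf c T₀ s₁) (boxOf c s₂)) j i).val) =
        listE (listE natE) (List.ofFn fun j => List.ofFn fun i => ((Amat B' N S q (noiseOf c T₀ s₁) (boxOf c s₂)) j i).val) := by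
      change (encodingFinVec Computability.encodingNatBool c.m).listBool.encode (List.ofFn fun j i => ((Amat B' N S q (noiseOf c T₀ s₁) (boxOf c s₂)) j i).val) = _
      rw [listE_eq]
      change listE (fun v : Fin c.m → ℕ => Computability.encodingNatBool.listBool.encode (List.ofFn v))
        (List.ofFn fun j i => ((Amat B' N S q (noiseOf c T₀ s₁) (boxOf c s₂)) j i).val) = _
      rw [listE_eq]
      simp only [listE, rawE, List.map_ofFn, List.length_ofFn, Function.comp_def]
      rfl
    rw [he]; rfl
  simp only [runSeg]
  rw [hK, hκ, hquery, hU, uVecL_eq, hBr, hDg]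

/-- **The law of the run over uniform coins is the fine-grid model, read through the output map.**
[cite: MicciancioRegev2007, Thm. 5.9 (proof, steps 2–4: the reduction's random choices)] -/
theorem map_runOut_eq_naturalAttemptWith (hd : c.d = attDataOf B' N S q) {T₀ : Fin c.d.n → ℤ} (hT : c.Tsh = vecL T₀)
    (B : RandAlg (List Bool) (List Bool)) {C : ℕ} (hC : c.coinTotal ≤ C) :
    (uniformOfFintype (List.Vector Bool C)).map (fun r => c.runOut B r.toList) =
      (naturalAttemptWith (q := q) B' N S c.P.lawPMF
          (fun A : Matrix (Fin c.d.n) (Fin c.m) (ZMod q) => (callLaw B c.W c.R (SIS.encodeMatrix A)).map (decodeIntVec c.m))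
          (fun i : Fin c.m => if (i : ℕ) = c.j₀ then T₀ else 0) c.ℓ).map
        fun u => rawE intE (edivL (mulVecL (rowsOf B') (vecL u)) (Dg B')) := by
  have h1 : c.len1 ≤ C := by unfold RunCtx.coinTotal at hC; omega
  have h2 : c.len2 ≤ C - c.len1 := by unfold RunCtx.coinTotal at hC; omega
  have h3 : c.W + c.R ≤ C - c.len1 - c.len2 := by unfold RunCtx.coinTotal at hC; omega
  set out : (Fin c.d.n → ℤ) → List Bool := fun u => rawE intE (edivL (mulVecL (rowsOf B') (vecL u)) (Dg B')) with hout
  set O : Matrix (Fin c.d.n) (Fin c.m) (ZMod q) → PMF (Fin c.m → ℤ) :=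
    fun A => (callLaw B c.W c.R (SIS.encodeMatrix A)).map (decodeIntVec c.m) with hO
  -- Step 1: the run through the three splits
  have hrun : (fun r : List.Vector Bool C => c.runOut B r.toList) = fun r =>
      out (uVec B' N S q (noiseOf c T₀ (vecSplit c.len1 C h1 r).1.toList) (boxOf c (vecSplit c.len2 (C - c.len1) h2 (vecSplit c.len1 C h1 r).2).1.toList)
        (decodeIntVec c.m (callRun B c.W c.R (SIS.encodeMatrix (Amat B' N S q (noiseOf c T₀ (vecSplit c.len1 C h1 r).1.toList)
          (boxOf c (vecSplit c.len2 (C - c.len1) h2 (vecSplit c.len1 C h1 r).2).1.toList)))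
          (vecSplit (c.W + c.R) (C - c.len1 - c.len2) h3 (vecSplit c.len2 (C - c.len1) h2 (vecSplit c.len1 C h1 r).2).2).1.toList))) := by
    funext r
    rw [runOut_eq_runSeg_split c B hC r, runSeg_eq_model hd hT B]
  -- Step 2: as iterated binds over the three uniform segments
  rw [hrun]
  rw [show (fun r : List.Vector Bool C => out (uVec B' N S q (noiseOf c T₀ (vecSplit c.len1 C h1 r).1.toList)
      (boxOf c (vecSplit c.len2 (C - c.len1) h2 (vecSplit c.len1 C h1 r).2).1.toList)
      (decodeIntVec c.m (callRun B c.W c.R (SIS.encodeMatrix (Amat B' N S q (noiseOf c T₀ (vecSplit c.len1 C h1 r).1.toList)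
        (boxOf c (vecSplit c.len2 (C - c.len1) h2 (vecSplit c.len1 C h1 r).2).1.toList)))
        (vecSplit (c.W + c.R) (C - c.len1 - c.len2) h3 (vecSplit c.len2 (C - c.len1) h2 (vecSplit c.len1 C h1 r).2).2).1.toList)))) =
      fun r => (fun (u : List.Vector Bool c.len1) (rest : List.Vector Bool (C - c.len1)) =>
        out (uVec B' N S q (noiseOf c T₀ u.toList) (boxOf c (vecSplit c.len2 (C - c.len1) h2 rest).1.toList)
          (decodeIntVec c.m (callRun B c.W c.R (SIS.encodeMatrix (Amat B' N S q (noiseOf c T₀ u.toList) (boxOf c (vecSplit c.len2 (C - c.len1) h2 rest).1.toList)))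
            (vecSplit (c.W + c.R) (C - c.len1 - c.len2) h3 (vecSplit c.len2 (C - c.len1) h2 rest).2).1.toList))))
        (vecSplit c.len1 C h1 r).1 (vecSplit c.len1 C h1 r).2 from rfl]
  rw [← PMF.bind_pure_comp, show (PMF.pure ∘ fun r : List.Vector Bool C => (fun (u : List.Vector Bool c.len1) (rest : List.Vector Bool (C - c.len1)) =>
        out (uVec B' N S q (noiseOf c T₀ u.toList) (boxOf c (vecSplit c.len2 (C - c.len1) h2 rest).1.toList)
          (decodeIntVec c.m (callRun B c.W c.R (SIS.encodeMatrix (Amat B' N S q (noiseOf c T₀ u.toList) (boxOf c (vecSplit c.len2 (C - c.len1) h2 rest).1.toList)))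
            (vecSplit (c.W + c.R) (C - c.len1 - c.len2) h3 (vecSplit c.len2 (C - c.len1) h2 rest).2).1.toList))))
        (vecSplit c.len1 C h1 r).1 (vecSplit c.len1 C h1 r).2) =
      fun r => (fun u rest => PMF.pure (out (uVec B' N S q (noiseOf c T₀ u.toList) (boxOf c (vecSplit c.len2 (C - c.len1) h2 rest).1.toList)
          (decodeIntVec c.m (callRun B c.W c.R (SIS.encodeMatrix (Amat B' N S q (noiseOf c T₀ u.toList) (boxOf c (vecSplit c.len2 (C - c.len1) h2 rest).1.toList)))
            (vecSplit (c.W + c.R) (C - c.len1 - c.len2) h3 (vecSplit c.len2 (C - c.len1) h2 rest).2).1.toList)))))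
        (vecSplit c.len1 C h1 r).1 (vecSplit c.len1 C h1 r).2 from rfl]
  rw [uniformVector_bind_split h1 (fun (u : List.Vector Bool c.len1) (rest : List.Vector Bool (C - c.len1)) =>
    PMF.pure (out (uVec B' N S q (noiseOf c T₀ u.toList) (boxOf c (vecSplit c.len2 (C - c.len1) h2 rest).1.toList)
      (decodeIntVec c.m (callRun B c.W c.R (SIS.encodeMatrix (Amat B' N S q (noiseOf c T₀ u.toList) (boxOf c (vecSplit c.len2 (C - c.len1) h2 rest).1.toList)))
        (vecSplit (c.W + c.R) (C - c.len1 - c.len2) h3 (vecSplit c.len2 (C - c.len1) h2 rest).2).1.toList)))))]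
  -- second split inside
  have hstep2 : ∀ u : List.Vector Bool c.len1,
      ((uniformOfFintype (List.Vector Bool (C - c.len1))).bind fun rest =>
        PMF.pure (out (uVec B' N S q (noiseOf c T₀ u.toList) (boxOf c (vecSplit c.len2 (C - c.len1) h2 rest).1.toList)
          (decodeIntVec c.m (callRun B c.W c.R (SIS.encodeMatrix (Amat B' N S q (noiseOf c T₀ u.toList) (boxOf c (vecSplit c.len2 (C - c.len1) h2 rest).1.toList)))
            (vecSplit (c.W + c.R) (C - c.len1 - c.len2) h3 (vecSplit c.len2 (C - c.len1) h2 rest).2).1.toList))))) =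
      (uniformOfFintype (List.Vector Bool c.len2)).bind fun v =>
        (uniformOfFintype (List.Vector Bool (C - c.len1 - c.len2))).bind fun w =>
          PMF.pure (out (uVec B' N S q (noiseOf c T₀ u.toList) (boxOf c v.toList)
            (decodeIntVec c.m (callRun B c.W c.R (SIS.encodeMatrix (Amat B' N S q (noiseOf c T₀ u.toList) (boxOf c v.toList)))
              (vecSplit (c.W + c.R) (C - c.len1 - c.len2) h3 w).1.toList)))) := by
    intro u
    exact uniformVector_bind_split h2 (fun v w => PMF.pure (out (uVec B' N S q (noiseOf c T₀ u.toList) (boxOf c v.toList)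
      (decodeIntVec c.m (callRun B c.W c.R (SIS.encodeMatrix (Amat B' N S q (noiseOf c T₀ u.toList) (boxOf c v.toList)))
        (vecSplit (c.W + c.R) (C - c.len1 - c.len2) h3 w).1.toList)))))
  simp only [hstep2]
  -- third: the prefix of the rest is uniform of length `W + R`
  have hstep3 : ∀ (K κ : Fin c.m → Fin c.d.n → ℤ),
      ((uniformOfFintype (List.Vector Bool (C - c.len1 - c.len2))).bind fun w =>
        PMF.pure (out (uVec B' N S q K κ (decodeIntVec c.m (callRun B c.W c.R (SIS.encodeMatrix (Amat B' N S q K κ))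
          (vecSplit (c.W + c.R) (C - c.len1 - c.len2) h3 w).1.toList))))) =
      (O (Amat B' N S q K κ)).map fun z => out (uVec B' N S q K κ z) := by
    intro K κ
    change (uniformOfFintype (List.Vector Bool (C - c.len1 - c.len2))).map
        ((fun s : List.Vector Bool (c.W + c.R) => out (uVec B' N S q K κ (decodeIntVec c.m (callRun B c.W c.R (SIS.encodeMatrix (Amat B' N S q K κ)) s.toList)))) ∘
          fun w => (vecSplit (c.W + c.R) (C - c.len1 - c.len2) h3 w).1) = _
    rw [← PMF.map_comp, uniformVector_map_take h3, hO]
    simp only [callLaw, PMF.map_comp, Function.comp_def]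
  simp only [hstep3]
  -- Step 3: push the noises and boxes through their laws
  have hnoise := map_noiseSeg_eq (c := c) T₀
  have hbox := map_boxSeg_eq (c := c)
  calc ((uniformOfFintype (List.Vector Bool c.len1)).bind fun u =>
        (uniformOfFintype (List.Vector Bool c.len2)).bind fun v =>
          (O (Amat B' N S q (noiseOf c T₀ u.toList) (boxOf c v.toList))).map fun z => out (uVec B' N S q (noiseOf c T₀ u.toList) (boxOf c v.toList) z))
      = ((uniformOfFintype (List.Vector Bool c.len1)).map fun u => noiseOf c T₀ u.toList).bind fun K =>
          ((uniformOfFintype (List.Vector Bool c.len2)).map fun v => boxOf c v.toList).bind fun κ =>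
            (O (Amat B' N S q K κ)).map fun z => out (uVec B' N S q K κ z) := by
        rw [PMF.bind_map]
        refine congrArg _ (funext fun u => ?_)
        simp only [Function.comp_apply]
        rw [PMF.bind_map]
        rfl
    _ = (indepLaw c.m fun i => gridNoiseWith c.P.lawPMF (if (i : ℕ) = c.j₀ then T₀ else 0)).bind fun K =>
          (indepLaw c.m fun _ => boxLaw c.d.n c.ℓ).bind fun κ => (O (Amat B' N S q K κ)).map fun z => out (uVec B' N S q K κ z) := by
        rw [hnoise, hbox]
    _ = (naturalAttemptWith B' N S c.P.lawPMF O (fun i : Fin c.m => if (i : ℕ) = c.j₀ then T₀ else 0) c.ℓ).map out := by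
        rw [naturalAttemptWith, PMF.map_bind]
        refine congrArg _ (funext fun K => ?_)
        rw [PMF.map_bind]
        refine congrArg _ (funext fun κ => ?_)
        simp only [hO, PMF.map_comp, Function.comp_def]

end Main

end MRThm59

end Literature.Algebra.EuclideanLattices

end
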